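import Mathlib
import Literature.Analysis.PDE.SingleEntropy.LipschitzTests
import HarnessLib

/-!
# The L-path potential of a curl-free `C¹` field on a square

Topic `Literature/Analysis/PDE/SingleEntropy` — part of the formalization of
De Lellis–Otto–Westdickenberg, *Minimal entropy conditions for Burgers equation*, Quart. Appl.
Math. 62 (2004) 687–700, Thm 2.3 / Cor 2.5 (the named fact
`Literature.Analysis.PDE.deLellisOttoWestdickenberg_singleEntropy`).

`hasLineDerivAt_lpath_fst/snd`: the L-path potential
`P(t,x) = ∫_{x₀}^{x} W₂(t,y) dy + ∫_{t₀}^{t} W₁(s,x₀) ds` (written inline) of a `C¹` field with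
`∂ₜW₂ = ∂ₓW₁` on the sup-norm ball (= open square) `ball p₀ R` has `∂ₜP = W₁`, `∂ₓP = W₂` there
(fundamental theorem of calculus and differentiation under the integral sign). [folklore]
-/

noncomputable section

open MeasureTheory Set Filter Metric ContinuousLinearMap
open scoped Topology Convolution NNReal

namespace Literature.Analysis.PDE.SingleEntropy

/-! ## The L-path potential of a curl-free `C¹` field on a square

For a `C¹` field `(W₁, W₂)` on the plane and a base point `p₀ = (t₀, x₀)` we consider
`P(t, x) = ∫_{x₀}^{x} W₂(t, y) dy + ∫_{t₀}^{t} W₁(s, x₀) ds` (written out inline). If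
`∂ₜW₂ = ∂ₓW₁` on the sup-norm ball (= open square) `ball p₀ R`, then `∂ₓP = W₂` and `∂ₜP = W₁`
there. -/

section SmoothPotential

/-- Membership in a sup-norm ball of the plane, coordinatewise. [folklore] -/
theorem mem_ball_prod_iff {p₀ z : ℝ × ℝ} {R : ℝ} :
    z ∈ ball p₀ R ↔ |z.1 - p₀.1| < R ∧ |z.2 - p₀.2| < R := by
  rw [mem_ball, Prod.dist_eq, max_lt_iff, Real.dist_eq, Real.dist_eq]

/-- `∂ₓ` of the L-path potential is `W₂` (fundamental theorem of calculus). [folklore] -/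
theorem hasLineDerivAt_lpath_snd {W₁ W₂ : ℝ × ℝ → ℝ} (hW₂ : Continuous W₂) (p₀ z : ℝ × ℝ) :
    HasLineDerivAt ℝ
      (fun z : ℝ × ℝ => (∫ y in p₀.2..z.2, W₂ (z.1, y)) + ∫ s in p₀.1..z.1, W₁ (s, p₀.2))
      (W₂ z) z (0, 1) := by
  unfold HasLineDerivAt
  have e : ∀ s : ℝ, z + s • ((0 : ℝ), (1 : ℝ)) = (z.1, z.2 + s) := fun s => by
    ext <;> simp
  simp_rw [e]
  have hc : Continuous fun y => W₂ (z.1, y) := hW₂.comp (by fun_prop)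
  have h1 : HasDerivAt (fun w => ∫ y in p₀.2..w, W₂ (z.1, y)) (W₂ (z.1, z.2 + 0)) (z.2 + 0) :=
    (hc.integral_hasStrictDerivAt p₀.2 _).hasDerivAt
  have h2 : HasDerivAt (fun s : ℝ => z.2 + s) 1 0 := by
    simpa using (hasDerivAt_id (0 : ℝ)).const_add z.2
  have h3 : HasDerivAt (fun s : ℝ => ∫ y in p₀.2..z.2 + s, W₂ (z.1, y)) (W₂ (z.1, z.2 + 0) * 1) 0 :=
    h1.comp 0 h2
  simp only [add_zero, mul_one] at h3
  exact h3.add_const _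

/-- `∂ₜ` of the L-path potential is `W₁` when `∂ₜW₂ = ∂ₓW₁` on the square (differentiation
under the integral sign and the fundamental theorem of calculus). [folklore] -/
theorem hasLineDerivAt_lpath_fst {W₁ W₂ : ℝ × ℝ → ℝ} (hW₁ : ContDiff ℝ 1 W₁) (hW₂ : ContDiff ℝ 1 W₂)
    {p₀ : ℝ × ℝ} {R : ℝ}
    (hcurl : ∀ w ∈ ball p₀ R, fderiv ℝ W₂ w (1, 0) = fderiv ℝ W₁ w (0, 1))
    {z : ℝ × ℝ} (hz : z ∈ ball p₀ R) :
    HasLineDerivAt ℝ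
      (fun z : ℝ × ℝ => (∫ y in p₀.2..z.2, W₂ (z.1, y)) + ∫ s in p₀.1..z.1, W₁ (s, p₀.2))
      (W₁ z) z (1, 0) := by
  unfold HasLineDerivAt
  have e : ∀ s : ℝ, z + s • ((1 : ℝ), (0 : ℝ)) = (z.1 + s, z.2) := fun s => by
    ext <;> simp
  simp_rw [e]
  have hW₂1 : Differentiable ℝ W₂ := hW₂.differentiable one_ne_zero
  have hW₁1 : Differentiable ℝ W₁ := hW₁.differentiable one_ne_zero
  have cdt : Continuous fun w => fderiv ℝ W₂ w (1, 0) :=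
    (hW₂.continuous_fderiv one_ne_zero).clm_apply continuous_const
  have cdx : Continuous fun w => fderiv ℝ W₁ w (0, 1) :=
    (hW₁.continuous_fderiv one_ne_zero).clm_apply continuous_const
  -- bound for the `t`-derivative of `W₂` near the segment
  obtain ⟨C, hC⟩ := ((isCompact_closedBall z.1 1).prod (isCompact_uIcc (a := p₀.2) (b := z.2)))
    |>.exists_bound_of_continuousOn (f := fun w : ℝ × ℝ => fderiv ℝ W₂ w (1, 0)) cdt.continuousOn
  -- derivative of the parametric integral
  have hA : HasDerivAt (fun s : ℝ => ∫ y in p₀.2..z.2, W₂ (z.1 + s, y))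
      (∫ y in p₀.2..z.2, fderiv ℝ W₂ (z.1 + 0, y) (1, 0)) 0 := by
    have key := intervalIntegral.hasDerivAt_integral_of_dominated_loc_of_deriv_le
      (μ := volume) (F := fun s y => W₂ (z.1 + s, y))
      (F' := fun s y => fderiv ℝ W₂ (z.1 + s, y) (1, 0)) (x₀ := (0 : ℝ))
      (s := ball 0 1) (bound := fun _ => C) (a := p₀.2) (b := z.2) (ball_mem_nhds 0 one_pos)
      ?_ ?_ ?_ ?_ ?_ ?_
    · exact key.2
    · exact Eventually.of_forall fun s =>
        (hW₂.continuous.comp (by fun_prop)).aestronglyMeasurable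
    · exact (hW₂.continuous.comp (by fun_prop)).intervalIntegrable _ _
    · exact (cdt.comp (by fun_prop)).aestronglyMeasurable
    · refine ae_of_all _ fun y hy s hs => hC (z.1 + s, y) (mem_prod.mpr ⟨?_, ?_⟩)
      · rw [mem_closedBall, Real.dist_eq]
        rw [mem_ball, Real.dist_eq, sub_zero] at hs
        have : |z.1 + s - z.1| = |s| := by ring_nf
        rw [this]; exact hs.le
      · exact uIoc_subset_uIcc hy
    · exact intervalIntegrable_const
    · refine ae_of_all _ fun y _ s _ => ?_
      have h1 : HasDerivAt (fun σ => W₂ (σ, y)) (fderiv ℝ W₂ (z.1 + s, y) (1, 0)) (z.1 + s) :=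
        hasDerivAt_slice_fst (hW₂1 _)
      have h2 : HasDerivAt (fun s : ℝ => z.1 + s) 1 s := by
        simpa using (hasDerivAt_id s).const_add z.1
      have h3 := h1.comp s h2
      simp only [mul_one] at h3
      exact h3
  -- use the curl identity on the segment and integrate
  have hB : ∫ y in p₀.2..z.2, fderiv ℝ W₂ (z.1 + 0, y) (1, 0) = W₁ z - W₁ (z.1, p₀.2) := by
    rw [add_zero]
    have hz' := mem_ball_prod_iff.mp hz
    have e1 : ∫ y in p₀.2..z.2, fderiv ℝ W₂ (z.1, y) (1, 0)
        = ∫ y in p₀.2..z.2, fderiv ℝ W₁ (z.1, y) (0, 1) := by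
      apply intervalIntegral.integral_congr
      intro y hy
      apply hcurl
      rw [mem_ball_prod_iff]
      refine ⟨hz'.1, ?_⟩
      rcases mem_uIcc.mp hy with ⟨h1, h2⟩ | ⟨h1, h2⟩
      · calc |y - p₀.2| = y - p₀.2 := abs_of_nonneg (by linarith)
          _ ≤ |z.2 - p₀.2| := by
            have := le_abs_self (z.2 - p₀.2); linarith
          _ < R := hz'.2
      · calc |y - p₀.2| = -(y - p₀.2) := abs_of_nonpos (by linarith)
          _ ≤ |z.2 - p₀.2| := by
            have := neg_abs_le (z.2 - p₀.2); linarith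
          _ < R := hz'.2
    rw [e1, intervalIntegral.integral_eq_sub_of_hasDerivAt (f := fun y => W₁ (z.1, y))
      (fun y _ => hasDerivAt_slice_snd (hW₁1 _)) ((cdx.comp (by fun_prop)).intervalIntegrable _ _)]
  have hD : HasDerivAt (fun s : ℝ => ∫ σ in p₀.1..z.1 + s, W₁ (σ, p₀.2)) (W₁ (z.1, p₀.2)) 0 := by
    have hc : Continuous fun σ => W₁ (σ, p₀.2) := hW₁.continuous.comp (by fun_prop)
    have h1 : HasDerivAt (fun w => ∫ σ in p₀.1..w, W₁ (σ, p₀.2)) (W₁ (z.1 + 0, p₀.2)) (z.1 + 0) :=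
      (hc.integral_hasStrictDerivAt p₀.1 _).hasDerivAt
    have h2 : HasDerivAt (fun s : ℝ => z.1 + s) 1 0 := by
      simpa using (hasDerivAt_id (0 : ℝ)).const_add z.1
    have h3 : HasDerivAt (fun s : ℝ => ∫ σ in p₀.1..z.1 + s, W₁ (σ, p₀.2))
        (W₁ (z.1 + 0, p₀.2) * 1) 0 := h1.comp 0 h2
    simp only [add_zero, mul_one] at h3
    exact h3
  have hsum := hA.add hD
  rw [hB] at hsum
  simp only [sub_add_cancel] at hsum
  exact hsum

end SmoothPotential

end Literature.Analysis.PDE.SingleEntropy
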